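import Summits.BirchSwinnertonDyer.BirchSwinnertonDyer.Theorems.PrintCf2RubinValueTwoLinePinDefectUndecomposedFrame
import Summits.BirchSwinnertonDyer.BirchSwinnertonDyer.Theorems.PrintCf2RubinValueTwoSignModuleRamificationTransport
import Summits.BirchSwinnertonDyer.BirchSwinnertonDyer.Theorems.EisensteinPrimesCharResidualSelmerKummer
import HarnessLib

/-!
# M-LINE-PIN, (C2b) part 6: THE CLASS-LEVEL STATEMENT — for `M = A_θ` (`θ² = 1`) on the road-α frame and the `v`-line `κ₁`:
# `ch_Λ(ker φ̄) = ((1+T) − θ(τ))^{corank(coker g)}` with `τ ∈ D_{v̄}`, `κ₁ τ = κ₁ γ₁`, and NO displayed input except (LS)_v and the class parity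

Cell `bsd-print-cf2`, width seat `bsd-line-cf2c-w8` g4 (prover-bsd-line-cf2c-w8-g4-0), planner g19's named piece M-LINE-PIN, step (C2b)
(memo `Cruxes/TwoVariableMainConjAtSplitTwo/M-LINE-PIN-cf2c-w8g3.md` §2/§8). Composition of parts 1–5 (p700499, p701343, p701925, p702352,
p703191) with cf2c-w2 g4's defect dual pair (p699750) for the character module `A_θ = charModule ∅ θ` of a QUADRATIC character `θ` at `p = 2`:
every `τ ∈ D_{v̄}` acts on `A_θ` by `±1` (`SignTransport.smul_charModule_eq_self_or_eq_neg_of_sq_eq_one`), and `2 ∣ (±1) − 1`.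
`--supports stmt-BirchSwinnertonDyer-24086 --as helper`, Theses-free. HONEST FRAMING: assembly; the displayed inputs that remain are
(LS)_v (as the number `corank_{ℤ₂}(coker g)`), the EVEN-local-class condition `hI` (`θ` trivial on `pairKer ⊓ I_{v̄}`; the odd class has a
finite defect — cf2c-w2 g4's lane), the generator-pair / partner data, the slot-1 control `g` with transpose `φ` ((C1)) and a presentation
`πC` of its cokernel. No summit statement is proved by this seat; BSD is not proved by any of this. THEOREMS ONLY (no definition, no named
fact, no `sorry`).

* `exists_int_smul_charModule_of_sq_eq_one` — `θ(τ)² = 1 ⟹ ∃ u ∈ {1, −1}, τ • a = u • a` on `A_θ`, with `2 ∣ u − 1`.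
* `exists_charIdeal_ker_liftQ_charModule_of_frame` — THE CLASS STATEMENT: on the frame (`K` imaginary quadratic, `θ_K² = −7`,
  `C • W = cm7^{(d)}`, `v ≠ v̄` above `2`), for the `v`-line `κ₁` (unramified outside `v`), a partner `κ₂` unramified outside `v̄`, a generator
  pair, a quadratic `θ` with `pairKer ⊓ I_{v̄}` trivial on `A_θ`, `D₂.X` f.g.: `∃ τ ∈ D_{v̄}, ∃ u, κ₁ τ = κ₁ γ₁ ∧ (u = 1 ∨ u = −1) ∧ τ = u on A_θ ∧
  ∀ φ̄ πC …, C[2] finite ∧ ch_Λ(ker φ̄) = ((1+T) − u)^{corank_{ℤ₂} C}`.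
presearch: as parts 1–5 (Greenberg–Vatsal 2000 Prop. (2.4), Greenberg LNM 1716 §3–4, Washington §13) — assembly. beyond-print theorem: no.

References: [GreenbergVatsal2000] §2 Cor. (2.3), Prop. (2.4); [GreenbergLNM1716] §1, §3–4; [KellerYin2024] §1.1; [Washington1997] §13.1–13.2.
-/

noncomputable section

open scoped Classical Pointwise AddSubgroup NumberField

-- the summit namespace `Summit.BirchSwinnertonDyer.BirchSwinnertonDyer` repeats the problem name by design (D-0017)
set_option linter.dupNamespace false
set_option autoImplicit false

open NumberField IsDedekindDomain Field WeierstrassCurve Literature.NumberTheory.GaloisRepresentations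
  Literature.NumberTheory.EllipticCurves Literature.NumberTheory.EllipticCurves.Module
  Literature.NumberTheory.EllipticCurves.IwasawaAlgebra Literature.NumberTheory.EllipticCurves.GreenbergSelmer
  Literature.NumberTheory.EllipticCurves.GreenbergVatsal2000 Literature.NumberTheory.EllipticCurves.KellerYin2024
  Literature.NumberTheory.EllipticCurves.IwasawaDual
open Summit.BirchSwinnertonDyer.BirchSwinnertonDyer.Theorems.PrintCf2

namespace Summit.BirchSwinnertonDyer.BirchSwinnertonDyer.Theorems.PrintCf2.LinePin

variable {K : Type} [Field K] [NumberField K]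

omit [NumberField K] in
/-- **A quadratic character acts on `A_θ` by an integer `u = ±1` with `2 ∣ u − 1`.** [cite: KellerYin2024, §1.1]
[cite: GreenbergLNM1716, §4 pp. 105–107] -/
theorem exists_int_smul_charModule_of_sq_eq_one {p : ℕ} [Fact p.Prime]
    (θ : FramedGaloisRep K (padicCoeffIntegers (∅ : Set (PadicAlgCl p))) 1) {τ : absoluteGaloisGroup K} (hτ : θ τ ^ 2 = 1) :
    ∃ u : ℤ, (u = 1 ∨ u = -1) ∧ (2 : ℤ) ∣ u - 1 ∧ ∀ a : charModule (∅ : Set (PadicAlgCl p)) θ, τ • a = u • a := by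
  rcases SignTransport.smul_charModule_eq_self_or_eq_neg_of_sq_eq_one θ hτ with ⟨-, h⟩ | ⟨-, -, h⟩
  · exact ⟨1, Or.inl rfl, ⟨0, by norm_num⟩, fun a ↦ by rw [h a, one_zsmul]⟩
  · exact ⟨-1, Or.inr rfl, ⟨-1, by norm_num⟩, fun a ↦ by rw [h a, neg_one_zsmul]⟩

/-- **(C2b) ON THE CLASS.** Road-α frame (`K` imaginary quadratic with `θ_K² = −7`, member `C • W = cm7^{(d)}`, `v ≠ v̄` the places above
`2`); `κ₁` the `ℤ₂`-line UNRAMIFIED OUTSIDE `v` (the first slot of M-LINE-PIN), `κ₂` a partner unramified outside `v̄`, `(γ₁, γ₂)` a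
generator pair; `θ` a QUADRATIC character (`θ(σ)² = 1`) whose module `A_θ` has `pairKer ⊓ I_{v̄}` acting trivially (the even local class);
the slot-1 control `g : H¹_nr(K_∞^{(v)}, A_θ) → H¹_nr(K̃_∞, A_θ)` with transpose `φ` ((C1)), `D₂.X` finitely generated over `Λ₂`, and a
presentation `πC` of the cokernel of control. THEN: there are `τ ∈ D_{v̄}` with `κ₁ τ = κ₁ γ₁` (part 5: `v̄` is undecomposed in the `v`-line)
and `u = θ(τ) ∈ {±1}`, and for every `Λ`-linear descent `φ̄` of `φ`: `C[2]` is finite and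
**`ch_Λ(ker φ̄) = ((1+T) − u)^{corank_{ℤ₂} C}`** — so (LS)_v «`corank_{ℤ₂} C = 1`» yields `ch_Λ(ker φ̄) = ((1+T) − u)`, the Euler factor at
`v̄`. [cite: GreenbergVatsal2000, §2 Cor. (2.3), Prop. (2.4)] [cite: GreenbergLNM1716, §3–4] [cite: Washington1997, §13.1–13.2] -/
theorem exists_charIdeal_ker_liftQ_charModule_of_frame (hK : IsImaginaryQuadratic K) {θK : K} (hθK : θK ^ 2 = -7) {d : ℤ}
    (hd0 : d ≠ 0) (W : WeierstrassCurve ℚ) [W.IsElliptic] {CW : VariableChange ℚ} (hCW : CW • W = cm7.quadraticTwist (d : ℚ))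
    {v vbar : HeightOneSpectrum (𝓞 K)} (hv : ((2 : ℕ) : 𝓞 K) ∈ v.asIdeal) (hvbar : ((2 : ℕ) : 𝓞 K) ∈ vbar.asIdeal) (hne : vbar ≠ v)
    {κ₁ κ₂ : ZpExtension K 2} (hκ₁ : κ₁.IsUnramifiedOutside v) (hκ₂ : κ₂.IsUnramifiedOutside vbar)
    {γ₁ γ₂ : absoluteGaloisGroup K} (hγ : ZpExtension.IsTopGeneratorPair κ₁ κ₂ γ₁ γ₂)
    (θ : FramedGaloisRep K (padicCoeffIntegers (∅ : Set (PadicAlgCl 2))) 1) (hθ2 : ∀ σ, θ σ ^ 2 = 1)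
    (hI : ∀ y : absoluteGaloisGroup K, y ∈ ZpExtension.pairKer κ₁ κ₂ → y ∈ inertia vbar →
      ∀ m : charModule (∅ : Set (PadicAlgCl 2)) θ, y • m = m)
    {g : unrSelmer κ₁ (charModule (∅ : Set (PadicAlgCl 2)) θ) vbar ∅ →+ unrSelmer₂ κ₁ κ₂ (charModule (∅ : Set (PadicAlgCl 2)) θ) vbar}
    (hg : ∀ t : unrSelmer κ₁ (charModule (∅ : Set (PadicAlgCl 2)) θ) vbar ∅,
      ((g t : unrSelmer₂ κ₁ κ₂ (charModule (∅ : Set (PadicAlgCl 2)) θ) vbar) :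
          subgroupH1 (ZpExtension.pairKer κ₁ κ₂) (charModule (∅ : Set (PadicAlgCl 2)) θ)) =
        resOfLe (charModule (∅ : Set (PadicAlgCl 2)) θ) (ZpExtension.pairKer_le_left κ₁ κ₂)
          (t : subgroupH1 κ₁.kerSubgroup (charModule (∅ : Set (PadicAlgCl 2)) θ)))
    {D₂ : DualData₂ κ₁ κ₂ (charModule (∅ : Set (PadicAlgCl 2)) θ) vbar γ₁ γ₂} [Module.Finite (IwasawaAlgebra₂ 2) D₂.X]
    {D₁ : DatumDualData κ₁ γ₁ (charModule (∅ : Set (PadicAlgCl 2)) θ)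
      (Castella2018.AcSelmer.bdpData (charModule (∅ : Set (PadicAlgCl 2)) θ) 2 vbar) ∅}
    {φ : D₂.X →ₛₗ[PowerSeries.map (PowerSeries.constantCoeff (R := ℤ_[2]))] D₁.X}
    (hφ : ∀ (x : D₂.X) (t : unrSelmer κ₁ (charModule (∅ : Set (PadicAlgCl 2)) θ) vbar ∅), D₁.toDual (φ x) t = D₂.toDual x (g t))
    {C : Type*} [AddCommGroup C]
    (πC : ↥(endInvariants (conjSel₂ κ₁ κ₂ (charModule (∅ : Set (PadicAlgCl 2)) θ) vbar γ₂ - 1)) →+ C) (hsurj : Function.Surjective πC)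
    (hker : ∀ s : ↥(endInvariants (conjSel₂ κ₁ κ₂ (charModule (∅ : Set (PadicAlgCl 2)) θ) vbar γ₂ - 1)),
      πC s = 0 ↔ (s : unrSelmer₂ κ₁ κ₂ (charModule (∅ : Set (PadicAlgCl 2)) θ) vbar) ∈ g.range) :
    letI : Module (IwasawaAlgebra 2) (QuotSMulTop (PowerSeries.C (PowerSeries.X : IwasawaAlgebra 2) : IwasawaAlgebra₂ 2) D₂.X) :=
      Module.compHom _ (PowerSeries.map (PowerSeries.C (R := ℤ_[2])))
    ∃ τ ∈ decomp vbar, ∃ u : ℤ, κ₁ τ = κ₁ γ₁ ∧ (u = 1 ∨ u = -1) ∧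
      (∀ m : charModule (∅ : Set (PadicAlgCl 2)) θ, τ • m = u • m) ∧
      ∀ (φbar : QuotSMulTop (PowerSeries.C (PowerSeries.X : IwasawaAlgebra 2) : IwasawaAlgebra₂ 2) D₂.X →ₗ[IwasawaAlgebra 2] D₁.X),
        (∀ x : D₂.X, φbar (Submodule.Quotient.mk x) = φ x) →
        Finite (C[(2 : ℤ)]) ∧
          charIdeal (IwasawaAlgebra 2) (LinearMap.ker φbar) =
            Ideal.span {((1 : IwasawaAlgebra 2) + PowerSeries.X) - (u : IwasawaAlgebra 2)} ^ zpCorank C 2 := by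
  -- `v̄` is undecomposed in the `v`-line (part 5)
  obtain ⟨τ, hτ, hκτ⟩ := exists_mem_decomp_vbar_apply_eq_of_isUnramifiedOutside hK hθK hd0 W hCW hv hvbar hne κ₁ hκ₁ hγ.left
  -- `τ` acts on `A_θ` by `u = ±1`
  obtain ⟨u, hu1, hpu, hu⟩ := exists_int_smul_charModule_of_sq_eq_one θ (hθ2 τ)
  -- the module `A_θ` is `2`-primary with continuous orbits
  have hcont : ∀ m : charModule (∅ : Set (PadicAlgCl 2)) θ, Continuous fun σ : absoluteGaloisGroup K ↦ σ • m :=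
    fun m ↦ CharResidualSelmerCount.continuous_smul_charModule θ m
  have hprim : ∀ m : charModule (∅ : Set (PadicAlgCl 2)) θ, ∃ k : ℕ, 2 ^ k • m = 0 :=
    fun m ↦ exists_pow_smul_cofree_eq_zero (∅ : Set (PadicAlgCl 2)) θ m
  refine ⟨τ, hτ, u, hκτ, hu1, hu, fun φbar hφbar ↦ ⟨?_, ?_⟩⟩
  · exact (finite_torsionBy_and_zpCorank_eq_lambdaInvariant_ker_liftQ hg hφ hγ hcont hprim hκ₂ hvbar hI hτ hκτ hu hpu
      πC hsurj hker φbar hφbar).1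
  · exact charIdeal_ker_liftQ_eq_span_pow_zpCorank hg hφ hγ hcont hprim hκ₂ hvbar hI hτ hκτ hu hpu πC hsurj hker φbar hφbar

end Summit.BirchSwinnertonDyer.BirchSwinnertonDyer.Theorems.PrintCf2.LinePin

end
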